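import Literature.MathematicalPhysics.KineticTheory.HarmonicChaosDecomposition
import HarnessLib

/-!
# Lattice Parseval identities on the Brillouin zone (helper `latticeParseval` for stub
`stub_wickShellStatic` of line `gram-pencil-harmonic-chaos`, crux
`EmbeddedDrudeMourre.DrudeDissolution`, item stmt-AtomisticToContinuum-12593; `--supports` file,
closes nothing)

WHAT. On the Brillouin zone `𝕋 = ℝ/2πℤ` with its Haar probability measure `μ𝕋` and Mathlib's
Fourier coefficients `fourierCoeff h y = ∫ e^{-iyk} h k dμ𝕋`:

1. (polarised Parseval / momentum conservation, degree 2) for continuous `h₁ h₂ : 𝕋 → ℂ`,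
   `∑_y ĥ₁(y) ĥ₂(y) = ∫ h₁(k) h₂(-k) dμ𝕋` (as a `HasSum`);
2. (degree 4) for continuous `h₁ … h₄`,
   `∑_y ĥ₁ĥ₂ĥ₃ĥ₄(y) = ∫_{𝕋3} h₁(k₁) h₂(k₂) h₃(k₃) h₄(-(k₁+k₂+k₃)) dμ𝕋3`.

HOW. (1) is `HilbertBasis.hasSum_inner_mul_inner` for the Fourier Hilbert basis of `L²(𝕋)`
applied to `x = (k ↦ conj (h₁ (-k)))` and `y = h₂`, using neg-invariance of Haar measure.
(2) follows from (1) and the convolution theorem `(g₁ ⋆ g₂)^ = ĝ₁ ĝ₂` (Fubini + translation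
invariance), applied to `h₂ ⋆ (h₃ ⋆ h₄)`, and Fubini on `μ𝕋3 = μ𝕋 ⊗ (μ𝕋 ⊗ μ𝕋)`
(convolutions are written out as explicit integrals; no definitions are introduced).
-/

noncomputable section

namespace Summit.AtomisticToContinuum.FouriersLaw.Theorems.DrudeDissolution.GramPencilHarmonicChaos

open MeasureTheory Filter Set Function Topology
open scoped InnerProductSpace ENNReal ComplexConjugate
open Literature.MathematicalPhysics.KineticTheory
open Literature.MathematicalPhysics.KineticTheory.HeatConduction
open HarmonicChaos ProbabilityTheory
open PinnedChainKinetic (𝕋 𝕋3 μ𝕋 μ𝕋3)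
open scoped Literature.MathematicalPhysics.KineticTheory.HeatConduction.PinnedChainKinetic

namespace LatticeParseval

/-! ### Integrability of continuous functions on the compact zone -/

/-- A continuous function on a compact space is integrable for a finite measure. [folklore] -/
theorem integrable_of_continuous_compactSpace {X : Type*} [TopologicalSpace X]
    [MeasurableSpace X] [OpensMeasurableSpace X] [CompactSpace X] {μ : Measure X}
    [IsFiniteMeasureOnCompacts μ] {f : X → ℂ} (hf : Continuous f) : Integrable f μ :=
  hf.integrable_of_hasCompactSupport (HasCompactSupport.of_compactSpace f)

/-- The Fourier character at a negated argument: `e_n(-x) = e_{-n}(x)`. [folklore] -/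
theorem fourier_apply_neg_arg (n : ℤ) (x : 𝕋) : fourier n (-x) = fourier (-n) x := by
  rw [fourier_apply, fourier_apply, zsmul_neg, neg_zsmul]

/-- `conj` of the Fourier coefficient of `k ↦ conj (h (-k))` is the Fourier coefficient of `h`
(neg-invariance of the Haar measure). [folklore] -/
theorem conj_fourierCoeff_conj_neg (h : 𝕋 → ℂ) (n : ℤ) :
    conj (fourierCoeff (fun k : 𝕋 => conj (h (-k))) n) = fourierCoeff h n := by
  simp only [fourierCoeff, smul_eq_mul]
  rw [← integral_conj]
  simp only [map_mul, Complex.conj_conj]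
  rw [← integral_neg_eq_self (fun k : 𝕋 => (fourier (-n)) k * h k) μ𝕋]
  refine integral_congr_ae (ae_of_all _ fun k => ?_)
  simp only [fourier_apply_neg_arg, fourier_neg, Complex.conj_conj]

/-! ### Part 1: polarised Parseval -/

/-- Polarised Parseval identity on the zone: for continuous `h₁ h₂`,
`∑_y ĥ₁(y) ĥ₂(y) = ∫ h₁(k) h₂(-k) dk`. [folklore] -/
theorem hasSum_fourierCoeff_mul (h₁ h₂ : 𝕋 → ℂ) (hh₁ : Continuous h₁) (hh₂ : Continuous h₂) :
    HasSum (fun y : ℤ => fourierCoeff h₁ y * fourierCoeff h₂ y)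
      (∫ k : 𝕋, h₁ k * h₂ (-k) ∂μ𝕋) := by
  set g : 𝕋 → ℂ := fun k => conj (h₁ (-k)) with hg_def
  have hg : Continuous g := (Complex.continuous_conj.comp (hh₁.comp continuous_neg))
  have hgm : MemLp g 2 μ𝕋 :=
    hg.memLp_of_hasCompactSupport (HasCompactSupport.of_compactSpace g)
  have h2m : MemLp h₂ 2 μ𝕋 :=
    hh₂.memLp_of_hasCompactSupport (HasCompactSupport.of_compactSpace h₂)
  set x : Lp ℂ 2 μ𝕋 := hgm.toLp g
  set y : Lp ℂ 2 μ𝕋 := h2m.toLp h₂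
  have hxg : fourierCoeff (x : 𝕋 → ℂ) = fourierCoeff g := fourierCoeff_congr_ae hgm.coeFn_toLp
  have hyh : fourierCoeff (y : 𝕋 → ℂ) = fourierCoeff h₂ := fourierCoeff_congr_ae h2m.coeFn_toLp
  have key := (fourierBasis (T := 2 * Real.pi)).hasSum_inner_mul_inner x y
  have hsummand : (fun i : ℤ => ⟪x, fourierBasis i⟫_ℂ * ⟪fourierBasis i, y⟫_ℂ) =
      fun i : ℤ => fourierCoeff h₁ i * fourierCoeff h₂ i := by
    funext i
    rw [← inner_conj_symm x, ← HilbertBasis.repr_apply_apply, ← HilbertBasis.repr_apply_apply,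
      fourierBasis_repr, fourierBasis_repr, hxg, hyh, conj_fourierCoeff_conj_neg]
  have hval : ⟪x, y⟫_ℂ = ∫ k : 𝕋, h₁ k * h₂ (-k) ∂μ𝕋 := by
    rw [L2.inner_def, ← integral_neg_eq_self (fun k : 𝕋 => h₁ k * h₂ (-k)) μ𝕋]
    refine integral_congr_ae ?_
    filter_upwards [hgm.coeFn_toLp, h2m.coeFn_toLp] with k hxk hyk
    rw [RCLike.inner_apply', hxk, hyk, hg_def]
    simp only [Complex.conj_conj, neg_neg]
  rwa [hsummand, hval] at key

/-- The Fourier character is multiplicative in its argument: `e_n(x + y) = e_n(x) e_n(y)`.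
[folklore] -/
theorem fourier_apply_add_arg (n : ℤ) (x y : 𝕋) :
    fourier n (x + y) = fourier n x * fourier n y := by
  rw [fourier_apply, fourier_apply, fourier_apply, zsmul_add, AddCircle.toCircle_add,
    Circle.coe_mul]

/-! ### Part 2: convolution on the zone and the degree-4 identity -/

/-- The convolution `(g₁ ⋆ g₂)(k) = ∫ g₁(u) g₂(k - u) du` (Haar probability measure) of
continuous functions on the (compact) zone is continuous. [folklore] -/
theorem continuous_zconv {g₁ g₂ : 𝕋 → ℂ} (hg₁ : Continuous g₁) (hg₂ : Continuous g₂) :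
    Continuous (fun k : 𝕋 => ∫ u, g₁ u * g₂ (k - u) ∂μ𝕋) := by
  have hF : Continuous (uncurry fun (k : 𝕋) (u : 𝕋) => g₁ u * g₂ (k - u)) := by
    change Continuous fun p : 𝕋 × 𝕋 => g₁ p.2 * g₂ (p.1 - p.2)
    fun_prop
  have h := continuous_parametric_integral_of_continuous (μ := μ𝕋) hF isCompact_univ
  rw [Measure.restrict_univ] at h
  exact h

/-- Convolution theorem on the zone: `(g₁ ⋆ g₂)^(n) = ĝ₁(n) ĝ₂(n)` for continuous `g₁ g₂`
(Fubini and translation invariance of the Haar measure). [folklore] -/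
theorem fourierCoeff_zconv {g₁ g₂ : 𝕋 → ℂ} (hg₁ : Continuous g₁) (hg₂ : Continuous g₂) (n : ℤ) :
    fourierCoeff (fun k : 𝕋 => ∫ u, g₁ u * g₂ (k - u) ∂μ𝕋) n =
      fourierCoeff g₁ n * fourierCoeff g₂ n := by
  simp only [fourierCoeff, smul_eq_mul]
  have step1 : ∫ k, fourier (-n) k * ∫ u, g₁ u * g₂ (k - u) ∂μ𝕋 ∂μ𝕋 =
      ∫ k, ∫ u, fourier (-n) k * (g₁ u * g₂ (k - u)) ∂μ𝕋 ∂μ𝕋 := by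
    refine integral_congr_ae (ae_of_all _ fun k => ?_)
    exact (integral_const_mul _ _).symm
  have hF : Integrable (uncurry fun (k : 𝕋) (u : 𝕋) => fourier (-n) k * (g₁ u * g₂ (k - u)))
      (μ𝕋.prod μ𝕋) := by
    refine integrable_of_continuous_compactSpace ?_
    change Continuous fun p : 𝕋 × 𝕋 => fourier (-n) p.1 * (g₁ p.2 * g₂ (p.1 - p.2))
    exact ((map_continuous _).comp continuous_fst).mul (by fun_prop)
  rw [step1, integral_integral_swap hF]
  have inner : ∀ u : 𝕋, ∫ k, fourier (-n) k * (g₁ u * g₂ (k - u)) ∂μ𝕋 =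
      fourier (-n) u * g₁ u * ∫ k, fourier (-n) k * g₂ k ∂μ𝕋 := by
    intro u
    rw [← integral_add_right_eq_self (fun k : 𝕋 => fourier (-n) k * (g₁ u * g₂ (k - u))) u,
      ← integral_const_mul]
    refine integral_congr_ae (ae_of_all _ fun k => ?_)
    simp only [add_sub_cancel_right, fourier_apply_add_arg]
    ring
  simp_rw [inner]
  rw [integral_mul_const]

/-- `-(k + u + v) = -k - u - v` on the zone. [folklore] -/
theorem neg_add_add_eq (k u v : 𝕋) : -(k + u + v) = -k - u - v := by abel

/-- Degree-4 lattice Parseval / momentum conservation: for continuous `h₁ … h₄`,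
`∑_y ĥ₁ĥ₂ĥ₃ĥ₄(y) = ∫ h₁(k₁)h₂(k₂)h₃(k₃)h₄(-(k₁+k₂+k₃)) dk₁dk₂dk₃`. [folklore] -/
theorem hasSum_fourierCoeff_mul_four (h₁ h₂ h₃ h₄ : 𝕋 → ℂ) (hh₁ : Continuous h₁)
    (hh₂ : Continuous h₂) (hh₃ : Continuous h₃) (hh₄ : Continuous h₄) :
    HasSum
      (fun y : ℤ => fourierCoeff h₁ y * fourierCoeff h₂ y * fourierCoeff h₃ y * fourierCoeff h₄ y)
      (∫ κ : 𝕋3, h₁ κ.1 * h₂ κ.2.1 * h₃ κ.2.2 * h₄ (-(κ.1 + κ.2.1 + κ.2.2)) ∂μ𝕋3) := by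
  -- the convolutions `H₃₄ = h₃ ⋆ h₄` and `H = h₂ ⋆ (h₃ ⋆ h₄)`
  set H₃₄ : 𝕋 → ℂ := fun k => ∫ v, h₃ v * h₄ (k - v) ∂μ𝕋 with hH₃₄_def
  set H : 𝕋 → ℂ := fun k => ∫ u, h₂ u * H₃₄ (k - u) ∂μ𝕋 with hH_def
  have h34 : Continuous H₃₄ := continuous_zconv hh₃ hh₄
  have hH : Continuous H := continuous_zconv hh₂ h34
  have key := hasSum_fourierCoeff_mul h₁ H hh₁ hH
  simp_rw [hH_def, fourierCoeff_zconv hh₂ h34, hH₃₄_def, fourierCoeff_zconv hh₃ hh₄] at key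
  have hsummand : (fun y : ℤ => fourierCoeff h₁ y *
      (fourierCoeff h₂ y * (fourierCoeff h₃ y * fourierCoeff h₄ y))) =
      fun y : ℤ =>
        fourierCoeff h₁ y * fourierCoeff h₂ y * fourierCoeff h₃ y * fourierCoeff h₄ y := by
    funext y; ring
  rw [hsummand] at key
  -- identify the value of the sum with the `𝕋3` integral by Fubini
  have hF : Continuous fun κ : 𝕋3 =>
      h₁ κ.1 * h₂ κ.2.1 * h₃ κ.2.2 * h₄ (-(κ.1 + κ.2.1 + κ.2.2)) := by fun_prop
  have hval : ∫ κ : 𝕋3, h₁ κ.1 * h₂ κ.2.1 * h₃ κ.2.2 * h₄ (-(κ.1 + κ.2.1 + κ.2.2)) ∂μ𝕋3 =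
      ∫ k, h₁ k * ∫ u, h₂ u * ∫ v, h₃ v * h₄ (-k - u - v) ∂μ𝕋 ∂μ𝕋 ∂μ𝕋 := by
    rw [integral_prod _ (integrable_of_continuous_compactSpace hF)]
    refine integral_congr_ae (ae_of_all _ fun k => ?_)
    have hFk : Continuous fun p : 𝕋 × 𝕋 =>
        h₁ k * h₂ p.1 * h₃ p.2 * h₄ (-(k + p.1 + p.2)) := by fun_prop
    simp only
    rw [integral_prod _ (integrable_of_continuous_compactSpace hFk)]
    rw [← integral_const_mul]
    refine integral_congr_ae (ae_of_all _ fun u => ?_)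
    simp only
    rw [← integral_const_mul, ← integral_const_mul]
    refine integral_congr_ae (ae_of_all _ fun v => ?_)
    simp only [neg_add_add_eq]
    ring
  rwa [← hval] at key

end LatticeParseval

/-- **Lattice Parseval / momentum conservation on the Brillouin zone.** (1) For continuous
`h₁ h₂ : 𝕋 → ℂ`, `∑_y ĥ₁(y) ĥ₂(y) = ∫ h₁(k) h₂(-k) dμ𝕋`; (2) for continuous `h₁ … h₄`,
`∑_y ĥ₁ĥ₂ĥ₃ĥ₄(y) = ∫_{𝕋3} h₁(k₁) h₂(k₂) h₃(k₃) h₄(-(k₁+k₂+k₃)) dμ𝕋3` (both as `HasSum` over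
`y : ℤ`, `fourierCoeff` w.r.t. the Haar probability measure). Polarised Parseval for the Fourier
Hilbert basis of `L²(𝕋)` plus the convolution theorem. [folklore] -/
theorem latticeParseval :
    (∀ h₁ h₂ : 𝕋 → ℂ, Continuous h₁ → Continuous h₂ →
        HasSum (fun y : ℤ => fourierCoeff h₁ y * fourierCoeff h₂ y) (∫ k : 𝕋, h₁ k * h₂ (-k) ∂μ𝕋)) ∧
    (∀ h₁ h₂ h₃ h₄ : 𝕋 → ℂ, Continuous h₁ → Continuous h₂ → Continuous h₃ → Continuous h₄ →
        HasSum (fun y : ℤ => fourierCoeff h₁ y * fourierCoeff h₂ y * fourierCoeff h₃ y * fourierCoeff h₄ y)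
          (∫ κ : 𝕋3, h₁ κ.1 * h₂ κ.2.1 * h₃ κ.2.2 * h₄ (-(κ.1 + κ.2.1 + κ.2.2)) ∂μ𝕋3)) :=
  ⟨LatticeParseval.hasSum_fourierCoeff_mul, LatticeParseval.hasSum_fourierCoeff_mul_four⟩

end Summit.AtomisticToContinuum.FouriersLaw.Theorems.DrudeDissolution.GramPencilHarmonicChaos

end
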